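import Mathlib
import HarnessLib

/-!
# Magnen–Rivasseau–Sénéor, *Construction of YM₄ with an infrared cutoff* (CMP 155, 1993), §II.B «The Small Field
# and Large Field Decomposition», pp.335–338 — the PHASE CELLS and the field «norms» AS PRINTED: the anisotropic
# boxes `𝐃_{i,α}` (sides `M^{−i}`, `M^{−α}`), the index `r(Δ) = (3i + α)/4`, the box functionals `E_Δ` (II.26) and
# `H_Δ` (II.29b) as power averages, the exponents `P_i`, `P_{1,i}`, `k(Δ)` (II.30), and the protection-corridor
# windows of `𝐃₁` and (II.31), typed as real definitions with elementary API proved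

statement-level skeleton of published definitions with citation tags; elementary API proved; nothing here is a claim
about the Yang–Mills mass gap, about continuum Yang–Mills on `T⁴`, or about the Clay problem

**Citation header (reproduction of PUBLISHED work).** J. Magnen, V. Rivasseau, R. Sénéor, *Construction of YM₄ with
an infrared cutoff*, Commun. Math. Phys. **155** (1993) 325–383 [MagnenRivasseauSeneor1993], Sect. II.B pp.334–338.
Loci `p.NNN tl.nn` = journal page / text-layer line of the held scan `paper:magnen1993-cmp155-mrs-ym4-infrared-cutoff`
(PDF page = journal page − 324); displays read on the decoded page images (crops `renders/p11_crop_r1500-3300_s2.png`,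
`p11_crop_r3200-4000_s2.png`, `p13_crop_r1300-3500_s2.png`, `p13_crop_r3400-4600_s2.png` in the seat folder of unit
`pub-balaban-gaps-mrs-lit-1`; renders of record `run/shared/lean/pub/lit-balaban/inprint/lit-balaban-p14/renders-cmp155/`).
Cell pub-balaban-gaps, track G3, seat mrs-lit-1 («statement layer: … norms, cutoffs»); companion prose
`run/shared/lean/pub/pub-balaban-gaps/g3/MRS-AS-PRINTED.md`. Siblings: `…MRS93StartingAnsatz` (the index set 𝐏,
the cutoffs), `…MRS93LargeFieldSmallFactor` (seat mrs-lit-2: Lemma II.1, the interpolations (II.25)/(II.29a) and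
the arithmetic (II.27)–(II.28) — not repeated here), `…MRS93MainStatement(Pinned)`.

**What the paper prints (verbatim).**
* p.335 tl.16–19: *«We introduce also anisotropic lattices 𝐃_{i,α} for (i, α) ∈ 𝐏. The union of these lattices is
  called 𝐃. 𝐃_{i,α} is the lattice of boxes of side M^{−i} in the directions 1, 2, 3 and of side M^{−α} in the
  direction 0. It is convenient to take M an integer and these boxes as refinements of a fixed lattice at the unit
  scale.»* (The display numbering passes from (II.23) to (II.25); no (II.24) is printed on p.335.)
* (II.26) p.335 tl.23–24: *«E_Δ = (1/Δ) ∫_Δ ((λ_i^t)^{1/2+ε₁} M^{−i} κ̃^{i,α} ∗ A)^{P_i}, (II.26) where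
  P_i = (λ_i^t)^{−ε₁/2}.»* — the functional of the box `Δ` entering the interpolation (II.25)
  `1 = e^{−E_Δ} + ∫₀¹ ds E_Δ e^{−(1−s)E_Δ}`; *«The set of boxes in which the error term is chosen in (II.25) is called
  the kernel of the large field region (KLFR).»* (tl.25–26).
* (II.29b)–(II.30) p.337 tl.15–22: *«H_Δ = (1/Δ) ∫_Δ ((λ_i^t)^{1−(ε₁/64)} M^{−2i} ∇B(Δ, x))^{P_{1,i}}, (II.29b) where
  P_{1,i} is an even integer close to (λ_i^t)^{−ε₁/32}, B(Δ, x) = Σ_{Δ′ ∈ D_{i′,α′}, r(Δ) > r(Δ′) − k(Δ)} χ_{Δ′}(x)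
  κ̃_{i′,α′} ∗ A (II.29c) with r(Δ) = (3i + α)/4, and if Δ ∈ 𝐃_{i,α}: M^{k(Δ)} = (λ_i^t)^{−ε₁/16}. (II.30)»*
* p.337 tl.23–29: *«The large field region is now defined as the set 𝐃₁ of boxes in which the error term of (II.25)
  is chosen, plus their protection corridors, i.e. the boxes Δ′ which intersect a box Δ of 𝐃₁ and satisfy to
  (λ_i^t)^{1/16} < M^{r(Δ)−r(Δ′)} < (λ_i^t)^{−1/16}, to which we add the set 𝐃₂ of boxes in which the error term in
  (II.29a) is chosen, plus a protection corridor around them of the same type but with smaller width, i.e. the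
  boxes Δ′ which intersect some Δ which belongs to 𝐃₂ and satisfy (λ_i^t)^{1/128} < M^{r(Δ)−r(Δ′)} <
  (λ_i^t)^{−1/128}. (II.31)»*; p.337 tl.1–2: the corridors' *«width both in space and momentum (index) directions
  be bounded»*; p.338 tl.8–9: *«The large field region is called LFR = ⋃_{i,α∈𝐏} L_{i,α}. Its complement is the
  small field region SFR = ⋃ S_{i,α}.»*

**What is typed here (definitions with bodies; elementary API kernel-checked, zero `sorry`, zero named facts).**
* §1 `boxSide M i α μ` (side `M^{−α}` for `μ = 0`, `M^{−i}` for `μ = 1,2,3`), `anisoBox M i α k ⊆ ℝ⁴` = the box of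
  `𝐃_{i,α}` with lower corner `k ∈ ℤ⁴` (product of half-open intervals — a reading: the print does not say which
  faces belong to a box), `latticeD M i α` = `𝐃_{i,α}`; `rIndex i α = (3i + α)/4`; **`volume_anisoBox`**: the
  volume of a box of `𝐃_{i,α}` is `M^{−(3i+α)} = M^{−4 r(Δ)}` (`volume_anisoBox_eq_rpow`) — so `r(Δ)` is a quarter
  of the logarithmic volume, the quantity the corridor windows compare.
* §2 `powerAverage Δ c P g = (1/|Δ|) ∫_Δ (c·g(x))^P dx` — the common shape of (II.26) and (II.29b) («1/Δ» read as
  `1/|Δ|`); `smallFieldE` = (II.26) with `c = (λ_i^t)^{1/2+ε₁} M^{−i}` and `largeGradH` = (II.29b) with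
  `c = (λ_i^t)^{1−ε₁/64} M^{−2i}`, over an ABSTRACT smeared field `g : ℝ⁴ → ℝ` (`κ̃^{i,α} ∗ A`, resp. `∇B(Δ, ·)`, are
  not constructed); the printed exponents `exponentP` (`(λ_i^t)^{−ε₁/2}`, a real number which the print then uses
  as an integer in (II.28) «(P_i/2)!» — we carry the power as a natural number `P` and the printed value
  separately), `exponentP1Target` (`(λ_i^t)^{−ε₁/32}`, «P_{1,i} is an even integer close to» it), `kIndex`
  ((II.30) solved: `k(Δ) = −(ε₁/16) ln λ_i^t / ln M`, `rpow_kIndex`); `powerAverage_nonneg` for even `P`.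
* §3 `InCorridor M lam e r r'` = the window `lam^e < M^{r−r′} < lam^{−e}` (`e = 1/16` for 𝐃₁, `e = 1/128` in
  (II.31)) and **`inCorridor_iff_abs_lt`**: for `0 < lam < 1 < M` it says exactly `|r − r′| · ln M < e · |ln lam|`
  — the printed «bounded width in index directions», with the width `e|ln λ|/ln M` explicit; `inCorridor_self`,
  `inCorridor_symm`, and `inCorridor_mono` (the (II.31) corridor, `e = 1/128`, lies inside the 𝐃₁-type one,
  `e = 1/16`: «of the same type but with smaller width»).

**What is NOT claimed or typed.** The smeared fields `κ̃^{i,α} ∗ A`, `B(Δ, x)` (II.29c) and the characteristic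
functions `χ_LFR`; the outcome sets 𝐃₁, 𝐃₂, KLFR, LFR, SFR themselves (they are random — produced by the expansions
(II.25)/(II.29a) — and are carried abstractly by `…MRS93LargeFieldSmallFactor.LargeField.LargeFieldData`); the
ancestor/relevant-box combinatorics of p.338; Lemma II.1; anything of Sects. IV–VII.
-/

noncomputable section

open MeasureTheory Set Real

namespace Literature.MathematicalPhysics.QuantumFieldTheory.MagnenRivasseauSeneor1993

namespace PhaseCells

/-! ## §1 The anisotropic boxes `𝐃_{i,α}` and the index `r(Δ)` -/

/-- Side lengths of a box of `𝐃_{i,α}`: *«of side M^{−i} in the directions 1, 2, 3 and of side M^{−α} in the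
direction 0»* (p.335 tl.17–18); `α ∈ ℤ` (the range `N_i ≤ α ≤ i + 1` of p.334 may start below `0`).
[cite: MagnenRivasseauSeneor1993, §II.B p.335 tl.16–19] -/
def boxSide (M : ℝ) (i : ℕ) (α : ℤ) (μ : Fin 4) : ℝ := if μ = 0 then M ^ (-α) else M ^ (-(i : ℤ))

/-- The box of `𝐃_{i,α}` with lower corner `k ∈ ℤ⁴` (in units of the sides): a product of half-open intervals —
«refinements of a fixed lattice at the unit scale» (p.335 tl.18–19). [cite: MagnenRivasseauSeneor1993, §II.B p.335 tl.16–19] -/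
def anisoBox (M : ℝ) (i : ℕ) (α : ℤ) (k : Fin 4 → ℤ) : Set (Fin 4 → ℝ) :=
  Set.pi Set.univ fun μ => Ico ((k μ : ℝ) * boxSide M i α μ) (((k μ : ℝ) + 1) * boxSide M i α μ)

/-- The lattice `𝐃_{i,α}` = the set of its boxes. [cite: MagnenRivasseauSeneor1993, §II.B p.335 tl.16–19] -/
def latticeD (M : ℝ) (i : ℕ) (α : ℤ) : Set (Set (Fin 4 → ℝ)) := Set.range (anisoBox M i α)

/-- *«r(Δ) = (3i + α)/4»* for `Δ ∈ 𝐃_{i,α}` ((II.29c), p.337 tl.21). [cite: MagnenRivasseauSeneor1993, (II.29c) p.337] -/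
def rIndex (i : ℕ) (α : ℤ) : ℝ := (3 * (i : ℝ) + α) / 4

/-- The sides are positive for `M > 0`. [cite: MagnenRivasseauSeneor1993, §II.B p.335 tl.16–19] -/
theorem boxSide_pos {M : ℝ} (hM : 0 < M) (i : ℕ) (α : ℤ) (μ : Fin 4) : 0 < boxSide M i α μ := by
  unfold boxSide; split_ifs <;> exact zpow_pos hM _

/-- The volume of a box of `𝐃_{i,α}`: `|Δ| = M^{−α} · (M^{−i})³`. [cite: MagnenRivasseauSeneor1993, §II.B p.335 tl.16–19] -/
theorem volume_anisoBox {M : ℝ} (hM : 0 < M) (i : ℕ) (α : ℤ) (k : Fin 4 → ℤ) :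
    (volume (anisoBox M i α k)).toReal = M ^ (-α) * (M ^ (-(i : ℤ))) ^ 3 := by
  unfold anisoBox
  rw [Real.volume_pi_Ico_toReal]
  · simp only [Fin.prod_univ_four, boxSide]
    simp
    ring
  · intro μ
    have := boxSide_pos hM i α μ
    nlinarith

/-- `|Δ| = M^{−4 r(Δ)}` — `r(Δ)` is a quarter of the logarithmic volume of the box (`M > 0`).
[cite: MagnenRivasseauSeneor1993, (II.29c) p.337 tl.21 and p.335 tl.16–19] -/
theorem volume_anisoBox_eq_rpow {M : ℝ} (hM : 0 < M) (i : ℕ) (α : ℤ) (k : Fin 4 → ℤ) :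
    (volume (anisoBox M i α k)).toReal = M ^ (-(4 * rIndex i α)) := by
  rw [volume_anisoBox hM, rIndex]
  rw [← Real.rpow_intCast, ← Real.rpow_intCast, ← Real.rpow_natCast, ← Real.rpow_mul hM.le,
    ← Real.rpow_add hM]
  congr 1
  push_cast
  ring

/-- Boxes are measurable sets. [cite: MagnenRivasseauSeneor1993, §II.B p.335 tl.16–19] -/
theorem measurableSet_anisoBox (M : ℝ) (i : ℕ) (α : ℤ) (k : Fin 4 → ℤ) : MeasurableSet (anisoBox M i α k) :=
  MeasurableSet.univ_pi fun _ => measurableSet_Ico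

/-! ## §2 The box functionals `E_Δ` (II.26), `H_Δ` (II.29b) and the printed exponents -/

/-- The common shape of (II.26) and (II.29b): the power average `(1/|Δ|) ∫_Δ (c · g(x))^P dx` of a (smeared)
field component `g` over the box `Δ` («1/Δ» read as `1/|Δ|`). [cite: MagnenRivasseauSeneor1993, (II.26) p.335 and (II.29b) p.337] -/
def powerAverage (Δ : Set (Fin 4 → ℝ)) (c : ℝ) (P : ℕ) (g : (Fin 4 → ℝ) → ℝ) : ℝ :=
  (volume Δ).toReal⁻¹ * ∫ x in Δ, (c * g x) ^ P

/-- (II.26): `E_Δ = (1/|Δ|) ∫_Δ ((λ_i^t)^{1/2+ε₁} M^{−i} · g)^{P}` with `g = κ̃^{i,α} ∗ A` the field of index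
`(i, α)` (abstract here) and `P` the power (printed value `P_i = (λ_i^t)^{−ε₁/2}`, `exponentP`).
[cite: MagnenRivasseauSeneor1993, (II.26) p.335] -/
def smallFieldE (Δ : Set (Fin 4 → ℝ)) (lam ε₁ M : ℝ) (i : ℕ) (P : ℕ) (g : (Fin 4 → ℝ) → ℝ) : ℝ :=
  powerAverage Δ (lam ^ (1 / 2 + ε₁) * M ^ (-(i : ℤ))) P g

/-- (II.29b): `H_Δ = (1/|Δ|) ∫_Δ ((λ_i^t)^{1−ε₁/64} M^{−2i} · g)^{P}` with `g = ∇B(Δ, ·)` (abstract here) and `P`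
the even power `P_{1,i}`. [cite: MagnenRivasseauSeneor1993, (II.29b) p.337] -/
def largeGradH (Δ : Set (Fin 4 → ℝ)) (lam ε₁ M : ℝ) (i : ℕ) (P : ℕ) (g : (Fin 4 → ℝ) → ℝ) : ℝ :=
  powerAverage Δ (lam ^ (1 - ε₁ / 64) * M ^ (-(2 * (i : ℤ)))) P g

/-- The printed value of the power in (II.26): *«P_i = (λ_i^t)^{−ε₁/2}»* (a real number; the print uses `P_i`
as an integer in (II.28), «(P_i/2)!»). [cite: MagnenRivasseauSeneor1993, (II.26) p.335 tl.24] -/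
def exponentP (lam ε₁ : ℝ) : ℝ := lam ^ (-(ε₁ / 2))

/-- The printed target of the power in (II.29b): *«P_{1,i} is an even integer close to (λ_i^t)^{−ε₁/32}»*.
[cite: MagnenRivasseauSeneor1993, (II.29b) p.337 tl.18] -/
def exponentP1Target (lam ε₁ : ℝ) : ℝ := lam ^ (-(ε₁ / 32))

/-- An admissible `P_{1,i}`: an even natural number (how «close» to the target is not quantified in print).
[cite: MagnenRivasseauSeneor1993, (II.29b) p.337 tl.18] -/
def IsAdmissibleP1 (P : ℕ) : Prop := Even P

/-- (II.30) solved for `k(Δ)`: `M^{k(Δ)} = (λ_i^t)^{−ε₁/16}` iff `k(Δ) = −(ε₁/16) ln λ_i^t / ln M` (`M > 1`).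
[cite: MagnenRivasseauSeneor1993, (II.30) p.337] -/
def kIndex (M lam ε₁ : ℝ) : ℝ := -(ε₁ / 16) * Real.log lam / Real.log M

/-- (II.30) as printed holds for `kIndex`: `M^{k(Δ)} = λ^{−ε₁/16}` (`0 < λ`, `1 < M`).
[cite: MagnenRivasseauSeneor1993, (II.30) p.337] -/
theorem rpow_kIndex {M lam : ℝ} (hM : 1 < M) (hlam : 0 < lam) (ε₁ : ℝ) :
    M ^ kIndex M lam ε₁ = lam ^ (-(ε₁ / 16)) := by
  have hM0 : 0 < M := by linarith
  have hlogM : Real.log M ≠ 0 := (Real.log_pos hM).ne'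
  rw [Real.rpow_def_of_pos hM0, Real.rpow_def_of_pos hlam, kIndex]
  congr 1
  field_simp

/-- For an even power the averages (II.26)/(II.29b) are nonnegative, whatever the sign of the field.
[cite: MagnenRivasseauSeneor1993, (II.26) p.335 and (II.29b) p.337] -/
theorem powerAverage_nonneg (Δ : Set (Fin 4 → ℝ)) (c : ℝ) {P : ℕ} (hP : Even P) (g : (Fin 4 → ℝ) → ℝ) :
    0 ≤ powerAverage Δ c P g := by
  unfold powerAverage
  refine mul_nonneg (inv_nonneg.mpr ENNReal.toReal_nonneg) ?_
  exact integral_nonneg fun x => hP.pow_nonneg _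

/-! ## §3 The protection-corridor windows -/

/-- The corridor window around a box: *«the boxes Δ′ which intersect a box Δ of 𝐃₁ and satisfy to
(λ_i^t)^{1/16} < M^{r(Δ)−r(Δ′)} < (λ_i^t)^{−1/16}»* (p.337 tl.24–25; `e = 1/16`) and (II.31) (`e = 1/128`), as a
predicate on the two indices `r = r(Δ)`, `r′ = r(Δ′)` (the geometric condition «intersect» is not typed).
[cite: MagnenRivasseauSeneor1993, (II.31) p.337] -/
def InCorridor (M lam e r r' : ℝ) : Prop := lam ^ e < M ^ (r - r') ∧ M ^ (r - r') < lam ^ (-e)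

/-- The window says exactly `|r(Δ) − r(Δ′)| · ln M < e · |ln λ_i^t|` (`0 < λ < 1 < M`): the corridors have
«bounded width in index directions» (p.337 tl.1–2), of half-width `e |ln λ| / ln M` in the index `r`.
[cite: MagnenRivasseauSeneor1993, (II.31) p.337 and p.337 tl.1–2] -/
theorem inCorridor_iff_abs_lt {M lam : ℝ} (hM : 1 < M) (hlam0 : 0 < lam) (hlam1 : lam < 1) (e r r' : ℝ) :
    InCorridor M lam e r r' ↔ |r - r'| * Real.log M < e * |Real.log lam| := by
  have hM0 : 0 < M := by linarith
  have hlogM : 0 < Real.log M := Real.log_pos hM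
  have hloglam : Real.log lam < 0 := Real.log_neg hlam0 hlam1
  rw [abs_of_neg hloglam]
  unfold InCorridor
  rw [← Real.log_lt_log_iff (Real.rpow_pos_of_pos hlam0 _) (Real.rpow_pos_of_pos hM0 _),
    ← Real.log_lt_log_iff (Real.rpow_pos_of_pos hM0 _) (Real.rpow_pos_of_pos hlam0 _),
    Real.log_rpow hlam0, Real.log_rpow hM0, Real.log_rpow hlam0]
  have key : |r - r'| * Real.log M = |(r - r') * Real.log M| := by rw [abs_mul, abs_of_pos hlogM]
  rw [key, abs_lt]
  constructor <;> rintro ⟨h1, h2⟩ <;> constructor <;> linarith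

/-- Every box is in its own corridor (`e > 0`, `0 < λ < 1`). [cite: MagnenRivasseauSeneor1993, (II.31) p.337] -/
theorem inCorridor_self {M lam e : ℝ} (hM : 1 < M) (hlam0 : 0 < lam) (hlam1 : lam < 1) (he : 0 < e) (r : ℝ) :
    InCorridor M lam e r r := by
  rw [inCorridor_iff_abs_lt hM hlam0 hlam1]
  have : 0 < |Real.log lam| := abs_pos.mpr (Real.log_neg hlam0 hlam1).ne
  simp only [sub_self, abs_zero, zero_mul]
  positivity

/-- The window is symmetric in the two boxes. [cite: MagnenRivasseauSeneor1993, (II.31) p.337] -/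
theorem inCorridor_symm {M lam e : ℝ} (hM : 1 < M) (hlam0 : 0 < lam) (hlam1 : lam < 1) (r r' : ℝ) :
    InCorridor M lam e r r' ↔ InCorridor M lam e r' r := by
  rw [inCorridor_iff_abs_lt hM hlam0 hlam1, inCorridor_iff_abs_lt hM hlam0 hlam1, abs_sub_comm]

/-- «of the same type but with smaller width» (p.337 tl.27): the window is monotone in `e`; in particular the
(II.31) corridor (`e = 1/128`) lies inside the 𝐃₁-type corridor (`e = 1/16`).
[cite: MagnenRivasseauSeneor1993, (II.31) p.337 tl.26–29] -/
theorem inCorridor_mono {M lam e e' : ℝ} (hM : 1 < M) (hlam0 : 0 < lam) (hlam1 : lam < 1) (hee' : e ≤ e')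
    {r r' : ℝ} (h : InCorridor M lam e r r') : InCorridor M lam e' r r' := by
  rw [inCorridor_iff_abs_lt hM hlam0 hlam1] at h ⊢
  exact h.trans_le (mul_le_mul_of_nonneg_right hee' (abs_nonneg _))

/-- The two printed widths: `1/128 ≤ 1/16`. [cite: MagnenRivasseauSeneor1993, (II.31) p.337] -/
theorem inCorridor_II31_of_D1 {M lam : ℝ} (hM : 1 < M) (hlam0 : 0 < lam) (hlam1 : lam < 1) {r r' : ℝ}
    (h : InCorridor M lam (1 / 128) r r') : InCorridor M lam (1 / 16) r r' :=
  inCorridor_mono hM hlam0 hlam1 (by norm_num) h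

end PhaseCells

end Literature.MathematicalPhysics.QuantumFieldTheory.MagnenRivasseauSeneor1993
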